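import Mathlib
import Summits.ValiantsHypothesis.ValiantsHypothesis.Theses.BarrierLever
import Summits.ValiantsHypothesis.ValiantsHypothesis.Theorems.BarrierLeverTransversalResultantKernelNonsingularTropical

/-!
# Route BarrierLever — conjecture CT (stmt-ValiantsHypothesis-19179): all PRINCIPAL layout minors
# of the transversal resultant kernel are nonzero (an infinite family via the tropical certificate)

CT (`TransversalResultantKernelNonsingular`) asks that every square layout minor
`det (∏_{a,c} (p (ρ_{u_i} a) − q (τ_{w_j} c)))_{i,j}` of the resultant kernel be nonzero for some
`p, q`. Here we settle the PRINCIPAL layouts `w = u` (same injective family of subsets on both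
sides, any `h`, any size `r ≤ 2^h` — in particular the full `2^h × 2^h` kernel, the Cauchy analogue
of the full rank of Nisan's partition matrix):

**Theorem (`resultantKernel_principal_layout_ne_zero`).** For every injective
`u : Fin r → Finset (Fin h)` there are `p, q ∈ ℂ^{h+h}` with
`det (∏_{a,c} (p (ρ_{u_i} a) − q (τ_{u_j} c)))_{i,j} ≠ 0`.

*Proof.* The tropical certificate `resultantKernel_layout_ne_zero_of_unique_assignment` with the
IDENTITY degeneration `μ x = some x`, unit weights: the cost of the pair `(i, j)` is the Hamming
distance `|u_i △ u_j|` (`ord_diag_eq_zero`, `one_le_ord_of_ne`), so the identity assignment has cost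
`0` and every other bijection has positive cost (`u` injective) — a unique optimum.

WHAT THIS IS NOT: CT for general layouts `w ≠ u` stays OPEN (kernel-reduced to the unique-assignment
combinatorics UT(μ), HOME/prover/gen5/UT-MEMO-g5.md); nothing on FSV Question 6 / crux 14610.
-/

-- layout Summits/ValiantsHypothesis/ValiantsHypothesis forces the duplicated namespace component
set_option linter.dupNamespace false

open Finset

namespace Summit.ValiantsHypothesis.ValiantsHypothesis.Theorems.BarrierLever.ResultantKernel

/-- Row and column transversals of the SAME set never meet: `ρ_u a ≠ τ_u c`
(`ρ_u a = a` iff `a ∈ u`, while `τ_u c = c` iff `c ∉ u`). -/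
theorem rowT_ne_colT_self {h : ℕ} (u : Finset (Fin h)) (a c : Fin h) :
    (if a ∈ u then Fin.castAdd h a else Fin.natAdd h a)
      ≠ (if c ∈ u then Fin.natAdd h c else Fin.castAdd h c) := by
  intro heq
  have hv := congrArg Fin.val heq
  have ha := a.isLt
  have hc := c.isLt
  by_cases hau : a ∈ u <;> by_cases hcu : c ∈ u <;>
    simp only [hau, hcu, if_true, if_false, Fin.val_castAdd, Fin.val_natAdd] at hv
  · omega
  · have : a = c := Fin.ext (by omega)
    exact hcu (this ▸ hau)
  · have : a = c := Fin.ext (by omega)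
    exact hau (this ▸ hcu)
  · omega

/-- At a coordinate `a ∈ u △ w`, the row transversal of `u` and the column transversal of `w`
pick the SAME index: `ρ_u a = τ_w a`. -/
theorem rowT_eq_colT_of_mem_symmDiff {h : ℕ} (u w : Finset (Fin h)) (a : Fin h)
    (ha : a ∈ u ∧ a ∉ w ∨ a ∉ u ∧ a ∈ w) :
    (if a ∈ u then Fin.castAdd h a else Fin.natAdd h a)
      = (if a ∈ w then Fin.natAdd h a else Fin.castAdd h a) := by
  rcases ha with ⟨hu, hw⟩ | ⟨hu, hw⟩
  · rw [if_pos hu, if_neg hw]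
  · rw [if_neg hu, if_pos hw]

/-- **All principal layout minors of the resultant kernel are nonzero** (CT for `w = u`). -/
theorem resultantKernel_principal_layout_ne_zero (h r : ℕ) (u : Fin r → Finset (Fin h))
    (hu : Function.Injective u) :
    ∃ p q : Fin (h + h) → ℂ, (Matrix.of fun i j : Fin r => ∏ a : Fin h, ∏ c : Fin h,
      (p (if a ∈ u i then Fin.castAdd h a else Fin.natAdd h a)
        - q (if c ∈ u j then Fin.natAdd h c else Fin.castAdd h c))).det ≠ 0 := by
  classical
  -- the identity degeneration with unit weights; `ord` is the defining double sum itself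
  refine resultantKernel_layout_ne_zero_of_unique_assignment h r u u (fun x => some x) (fun _ => 1)
    (fun i j => ∑ a : Fin h, ∑ c : Fin h,
      if (some (if a ∈ u i then Fin.castAdd h a else Fin.natAdd h a) : Option (Fin (h + h)))
          = some (if c ∈ u j then Fin.natAdd h c else Fin.castAdd h c)
      then 1 else 0)
    (fun i j => rfl) 1 ?_
  -- diagonal costs vanish
  have hdiag : ∀ j : Fin r, (∑ a : Fin h, ∑ c : Fin h,
      if (some (if a ∈ u j then Fin.castAdd h a else Fin.natAdd h a) : Option (Fin (h + h)))
          = some (if c ∈ u j then Fin.natAdd h c else Fin.castAdd h c)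
      then (1 : ℕ) else 0) = 0 := by
    intro j
    refine Finset.sum_eq_zero fun a _ => Finset.sum_eq_zero fun c _ => ?_
    rw [if_neg]
    intro heq
    exact rowT_ne_colT_self (u j) a c (Option.some_injective _ heq)
  -- off the identity some cost is positive
  intro σ hσ
  have hzero : ∑ j : Fin r, (∑ a : Fin h, ∑ c : Fin h,
      if (some (if a ∈ u ((1 : Equiv.Perm (Fin r)) j) then Fin.castAdd h a else Fin.natAdd h a) :
            Option (Fin (h + h)))
          = some (if c ∈ u j then Fin.natAdd h c else Fin.castAdd h c)
      then (1 : ℕ) else 0) = 0 := by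
    refine Finset.sum_eq_zero fun j _ => ?_
    rw [Equiv.Perm.one_apply]
    exact hdiag j
  rw [hzero]
  -- pick `j₀` moved by `σ` and a coordinate in the symmetric difference
  obtain ⟨j₀, hj₀⟩ : ∃ j₀, σ j₀ ≠ j₀ := by
    by_contra hcon
    push Not at hcon
    exact hσ (Equiv.ext fun j => by rw [hcon j, Equiv.Perm.one_apply])
  have hne : u (σ j₀) ≠ u j₀ := fun heq => hj₀ (hu heq)
  obtain ⟨a₀, ha₀⟩ : ∃ a₀ : Fin h, a₀ ∈ u (σ j₀) ∧ a₀ ∉ u j₀ ∨ a₀ ∉ u (σ j₀) ∧ a₀ ∈ u j₀ := by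
    by_contra hcon
    push Not at hcon
    apply hne
    ext a
    constructor
    · intro ha
      by_contra hna
      exact hna ((hcon a).1 ha)
    · intro ha
      by_contra hna
      exact (hcon a).2 hna ha
  refine Nat.pos_of_ne_zero fun hsum => ?_
  have hj := (Finset.sum_eq_zero_iff.1 hsum) j₀ (Finset.mem_univ _)
  have ha := (Finset.sum_eq_zero_iff.1 hj) a₀ (Finset.mem_univ _)
  have hc := (Finset.sum_eq_zero_iff.1 ha) a₀ (Finset.mem_univ _)
  rw [if_pos (congrArg some (rowT_eq_colT_of_mem_symmDiff (u (σ j₀)) (u j₀) a₀ ha₀))] at hc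
  exact one_ne_zero hc

/-- In particular the FULL `2^h × 2^h` transversal resultant kernel (all subsets on both sides,
in any common enumeration) is nonsingular for some `p, q`. -/
theorem resultantKernel_full_ne_zero (h : ℕ) (e : Fin (2 ^ h) ≃ Finset (Fin h)) :
    ∃ p q : Fin (h + h) → ℂ, (Matrix.of fun i j : Fin (2 ^ h) => ∏ a : Fin h, ∏ c : Fin h,
      (p (if a ∈ e i then Fin.castAdd h a else Fin.natAdd h a)
        - q (if c ∈ e j then Fin.natAdd h c else Fin.castAdd h c))).det ≠ 0 :=
  resultantKernel_principal_layout_ne_zero h (2 ^ h) e e.injective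

end Summit.ValiantsHypothesis.ValiantsHypothesis.Theorems.BarrierLever.ResultantKernel
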